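/-
Copyright (c) 2026 the pub-hodgecm-mathlib formalisation cell (harness21).  Prover seat hodgecm-mathlib-K2E3-p17 (g6), Track B «K2-LIT» ∕ h413
(`stmt-HodgeConjecture-24833`), line `K2_E3_EllipticInputs`, unit U12 §L, Richardson road for (LBGL-ge3) at `N = 3` (road owner K2E3-p11),
brick (F-J) = (S-B♭)_Lie, FILE F2b «(IMF) THE LEVEL-`k` PRODUCT FORMULA FOR `κ` ON THE DIAGONAL-UNIT ∕ OFF-DIAGONAL-`𝔭^k` PART OF `GL₃(𝒪)`».  2026-09-04.
-/
import Summits.HodgeConjecture.HodgeConjecture.Theorems.K2E3GL3DiagonalUnitSections      -- ★ (this seat, F2a): det∕unit lemmas, `map_mul_diagonal_eq_self`, the `Y`-sections; brings ★ F1 `exists_depth_uldChart`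
import Summits.HodgeConjecture.HodgeConjecture.Theorems.K2E3GLnIntegerPointsHaarVsAddHaar  -- ★ p857560 (K2E3-p06, brick C): `exists_lintegral_glInt_eq_mul_setLIntegral` (κ = c·μ𝔤|_K)
import HarnessLib

/-!
# K2_E3 road (h413), §L ∕ Richardson road at `N = 3`, brick (F-J) FILE F2b: (IMF) — on `C_k = {k ∈ GL₃(𝒪) | off-diagonal entries ∈ 𝔭^k}` every Haar measure `κ` of
# `GL₃(𝒪)` integrates right-`A(𝒪)`-invariant test functions like the box measure of the ULD coordinates `(X⁺, X⁻)`, with a LEVEL-UNIFORM constant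

Cell `pub/hodgecm-mathlib` (D-0151), Track B, seat K2E3-p17 (g6), deal (D60) = (F-J) (road owner K2E3-p11; census `K2/K2E3-p17/g6/CENSUS-SBflatLie-N3.K2E3-p17-g6.md` §1 (iv),
brick F).  `--supports stmt-HodgeConjecture-24833 --as helper`; THEOREMS ONLY (no definition ∕ instance ∕ notation ∕ named fact ∕ `sorry`); never imports `Cruxes/…/Lines`.
COUNT-NEUTRAL.

THE RESULT (**`exists_lintegral_offDiagLevel_eq`**).  For a Haar measure `κ` of `K = GL₃(𝒪)` (★ `glInt`), additive Haar measures `μ𝔤` of `M₃(F)` and `dx` of `F`, there are `c ∈ (0, ∞)` and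
`k₁` such that for every `k ≥ k₁` and every measurable `Θ : M₃(F) → [0, ∞]` which is RIGHT-INVARIANT UNDER THE INTEGRAL TORUS (`Θ(Y·diagonal a) = Θ(Y)` whenever all
`‖a_i‖_F = 1`):
  `dx(𝔭^k)³ · ∫⁻_{k ∈ K, off-diag(k) ∈ 𝔭^k} Θ(↑k) dκ = c · ∫⁻_{X ∈ M₃(𝔭^k)} Θ((1 + X⁺)(1 + X⁻)) dμ𝔤`.
This is the structural input (IMF) of FILE G2: the `K × N₃`-orbital integral near a regular diagonal point pulls back through the orbit chart to the box measure.
THE PROOF (no coset representatives, no index counting): (1) ★ brick C reads the `κ`-integral as `c_K ∫_{D_k} Θ dμ𝔤`, `D_k = {Y ∈ M₃(𝒪) : ‖det Y‖ = 1, off-diag ∈ 𝔭^k}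
= {diagonal UNITS, off-diag ∈ 𝔭^k}` (`normAbs_det_eq_one_iff_diag` — Sarrus + the strong triangle inequality); (2) AVERAGING over `u ∈ (𝒪ˣ)³`: Tonelli for
`Φ(u, Y) = 1_{D_k}(Y)·1[u − diag Y ∈ (𝔭^k)³]·Θ(Y)` on `F³ × M₃(F)` gives `dx(𝔭^k)³ · ∫_{D_k} Θ = dx(𝒪ˣ)³ · ∫_{K_k} Θ`, because the `Y`-section at a unit `u` is
`K_k · diagonal u` (`K_k = 1 + M₃(𝔭^k)`), right multiplication by `diagonal u` PRESERVES `μ𝔤` (an entrywise scaling by units: Haar character `‖∏ u_j‖³ = 1`, ★ E2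
`addEquivAddHaarChar_scaling`) and `Θ` is right-invariant; (3) ★ F1: `∫_{K_k} Θ = ∫_{M₃(𝔭^k)} Θ(M X)`, and `Θ(M X) = Θ((1+X⁺)(1+X⁻))` since `1 + X_d` is an integral diagonal unit.
[HarishChandra1999AdmissibleDistributions, Lemma 7.8] [BernsteinZelevinsky1976, §3] [WeilBNT1967, Ch. I §2, II §2]
HONEST LABEL: HC_CM is proved only modulo the 7 printed citations (2 remaining named inputs: hLiu418 = stmt-HodgeConjecture-24832, h413 = stmt-HodgeConjecture-24833)
until rung 0 closes; count-neutral helper ((LBGL-ge3)∕(LBGL-3J) NOT ★ here).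

## References
* [HarishChandra1999AdmissibleDistributions] Harish-Chandra (DeBacker–Sally), *Admissible Invariant Distributions on Reductive p-adic Groups* (1999), §7, Lemma 7.8.
* [BernsteinZelevinsky1976] I. N. Bernstein, A. V. Zelevinsky, *Representations of the group GL(n,F)*, Russian Math. Surveys 31:3 (1976), §3.
* [WeilBNT1967] A. Weil, *Basic Number Theory* (1967), Ch. I §2, Ch. II §2.
-/

set_option autoImplicit false
set_option linter.dupNamespace false

noncomputable section

open MeasureTheory Measure Filter Topology Set Matrix ValuativeRel
open scoped MatrixGroups NNReal ENNReal Pointwise Valued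
open Literature.NumberTheory.Automorphic Literature.NumberTheory.Automorphic.LocalFieldHaar
open Literature.NumberTheory.GaloisRepresentations Literature.NumberTheory.GaloisRepresentations.IsNonarchimedeanLocalField
open Summit.HodgeConjecture.HodgeConjecture.Cruxes.H413.K2E3GLnMaximalParabolicDescent
open Summit.HodgeConjecture.HodgeConjecture.Cruxes.H413.K2E3GL3RegularDiagonalOrbitChart
open Summit.HodgeConjecture.HodgeConjecture.Cruxes.H413.K2E3GL3ULDChart
open Summit.HodgeConjecture.HodgeConjecture.Cruxes.H413.K2E3GL3DiagonalUnitSections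

namespace Summit.HodgeConjecture.HodgeConjecture.Cruxes.H413.K2E3GL3DiagonalLevelProductMeasure

variable {F : Type*} [Field F] [ValuativeRel F] [TopologicalSpace F] [IsNonarchimedeanLocalField F]

/-! ## §4  The averaging identity and THE HEAD (IMF) -/

section Head

variable [MeasurableSpace F] [BorelSpace F] [MeasurableSpace (Matrix (Fin 3) (Fin 3) F)] [BorelSpace (Matrix (Fin 3) (Fin 3) F)]

/-- **AVERAGING OVER THE INTEGRAL TORUS** (`k ≥ 1`): `dx(𝔭^k)³ · ∫⁻_{D_k} Θ dμ𝔤 = dx(𝒪ˣ)³ · ∫⁻_{K_k} Θ dμ𝔤` for a measurable right-`A(𝒪)`-invariant `Θ`, where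
`D_k = {Y ∈ M₃(𝒪) : ‖det Y‖ = 1, off-diag ∈ 𝔭^k}` and `K_k = 1 + M₃(𝔭^k)` (Tonelli for `Φ(u, Y) = 1_{D_k}(Y)·1[u − diag Y ∈ (𝔭^k)³]·Θ(Y)`; the `Y`-section at a unit `u` is
`K_k · diagonal u` and right multiplication by `diagonal u` preserves `μ𝔤`). [cite: WeilBNT1967, Ch. II §2] [cite: BernsteinZelevinsky1976, §3] -/
theorem averaging_identity (μ𝔤 : Measure (Matrix (Fin 3) (Fin 3) F)) [μ𝔤.IsAddHaarMeasure] (dx : Measure F) [dx.IsAddHaarMeasure]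
    {k : ℕ} (hk : 1 ≤ k) (Θ : Matrix (Fin 3) (Fin 3) F → ℝ≥0∞) (hΘm : Measurable Θ)
    (hΘinv : ∀ (Y : Matrix (Fin 3) (Fin 3) F) (a : Fin 3 → F), (∀ i, normAbs F (a i) = 1) → Θ (Y * Matrix.diagonal a) = Θ Y) :
    dx (primePowBall F k) ^ 3 *
        ∫⁻ Y in {Y : Matrix (Fin 3) (Fin 3) F | (∀ i j, Y i j ∈ 𝒪[F]) ∧ normAbs F Y.det = 1} ∩ {Y | ∀ i j, i ≠ j → Y i j ∈ primePowBall F k}, Θ Y ∂μ𝔤 =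
      dx {x : F | normAbs F x = 1} ^ 3 * ∫⁻ Y in {Y : Matrix (Fin 3) (Fin 3) F | ∀ i j, (Y - 1) i j ∈ primePowBall F k}, Θ Y ∂μ𝔤 := by
  classical
  haveI : T2Space F := (isLocalField F).toT2Space
  haveI : LocallyCompactSpace F := (isLocalField F).toLocallyCompactSpace
  haveI : SecondCountableTopology F := secondCountableTopology_localField F
  haveI : IsTopologicalRing F := inferInstance
  haveI : SFinite dx := inferInstance
  haveI : LocallyCompactSpace (Matrix (Fin 3) (Fin 3) F) := locallyCompactSpace_matrix (F := F) (m := Fin 3) (n := Fin 3)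
  haveI : SecondCountableTopology (Matrix (Fin 3) (Fin 3) F) := secondCountableTopology_matrix (F := F) (m := Fin 3) (n := Fin 3)
  haveI : SFinite μ𝔤 := inferInstance
  set D : Set (Matrix (Fin 3) (Fin 3) F) :=
    {Y : Matrix (Fin 3) (Fin 3) F | (∀ i j, Y i j ∈ 𝒪[F]) ∧ normAbs F Y.det = 1} ∩ {Y | ∀ i j, i ≠ j → Y i j ∈ primePowBall F k} with hD
  set Kk : Set (Matrix (Fin 3) (Fin 3) F) := {Y : Matrix (Fin 3) (Fin 3) F | ∀ i j, (Y - 1) i j ∈ primePowBall F k} with hKk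
  set B : Set (Fin 3 → F) := Set.univ.pi fun _ : Fin 3 => primePowBall F k with hB
  set U3 : Set (Fin 3 → F) := Set.univ.pi fun _ : Fin 3 => {x : F | normAbs F x = 1} with hU3
  set π : Measure (Fin 3 → F) := Measure.pi fun _ : Fin 3 => dx with hπ
  -- measurability
  have hmeas_entry : ∀ i j : Fin 3, Measurable fun Y : Matrix (Fin 3) (Fin 3) F => Y i j := fun i j => (continuous_id.matrix_elem i j).measurable
  have hball : MeasurableSet (primePowBall F (k : ℤ)) := (isOpen_primePowBall (F := F) k).measurableSet
  have hint_m : MeasurableSet {x : F | x ∈ 𝒪[F]} := by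
    have : {x : F | x ∈ 𝒪[F]} = primePowBall F 0 := by ext x; exact mem_primePowBall_zero_iff.symm
    rw [this]; exact (isOpen_primePowBall (F := F) 0).measurableSet
  have hU_m : MeasurableSet {x : F | normAbs F x = 1} := measurableSet_eq_fun measurable_normAbs measurable_const
  have hD_m : MeasurableSet D := by
    have h : D = ((⋂ i : Fin 3, ⋂ j : Fin 3, (fun Y : Matrix (Fin 3) (Fin 3) F => Y i j) ⁻¹' {x : F | x ∈ 𝒪[F]}) ∩
        (fun Y : Matrix (Fin 3) (Fin 3) F => normAbs F Y.det) ⁻¹' {1}) ∩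
        ⋂ i : Fin 3, ⋂ j : Fin 3, ⋂ (_ : i ≠ j), (fun Y : Matrix (Fin 3) (Fin 3) F => Y i j) ⁻¹' primePowBall F k := by
      ext Y
      simp only [hD, Set.mem_inter_iff, Set.mem_setOf_eq, Set.mem_iInter, Set.mem_preimage, Set.mem_singleton_iff]
    rw [h]
    exact ((MeasurableSet.iInter fun i => MeasurableSet.iInter fun j => hmeas_entry i j hint_m).inter
      ((measurable_normAbs.comp (continuous_id.matrix_det).measurable) (measurableSet_singleton 1))).inter
      (MeasurableSet.iInter fun i => MeasurableSet.iInter fun j => MeasurableSet.iInter fun _ => hmeas_entry i j hball)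
  have hKk_m : MeasurableSet Kk := by
    have h : Kk = ⋂ i : Fin 3, ⋂ j : Fin 3, (fun Y : Matrix (Fin 3) (Fin 3) F => (Y - 1) i j) ⁻¹' primePowBall F k := by
      ext Y; simp only [hKk, Set.mem_setOf_eq, Set.mem_iInter, Set.mem_preimage]
    rw [h]
    exact MeasurableSet.iInter fun i => MeasurableSet.iInter fun j => ((continuous_id.sub continuous_const).matrix_elem i j).measurable hball
  have hB_m : MeasurableSet B := MeasurableSet.univ_pi fun _ => hball
  have hU3_m : MeasurableSet U3 := MeasurableSet.univ_pi fun _ => hU_m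
  have hdiag_m : Measurable fun Y : Matrix (Fin 3) (Fin 3) F => fun i => Y i i := measurable_pi_lambda _ fun i => hmeas_entry i i
  -- the integrand
  set Φ : (Fin 3 → F) × Matrix (Fin 3) (Fin 3) F → ℝ≥0∞ := fun p => D.indicator Θ p.2 * B.indicator (fun _ => 1) (p.1 - fun i => p.2 i i) with hΦ
  have hΦm : Measurable Φ :=
    ((hΘm.indicator hD_m).comp measurable_snd).mul
      ((measurable_const.indicator hB_m).comp (measurable_fst.sub (hdiag_m.comp measurable_snd)))
  -- (i) integrate in `u` first: translation invariance of `π`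
  have hu_inner : ∀ Y : Matrix (Fin 3) (Fin 3) F, ∫⁻ u, Φ (u, Y) ∂π = D.indicator Θ Y * dx (primePowBall F k) ^ 3 := by
    intro Y
    simp only [hΦ]
    rw [lintegral_const_mul (D.indicator Θ Y) (f := fun u : Fin 3 → F => B.indicator (fun _ => (1 : ℝ≥0∞)) (u - fun i => Y i i))
      ((measurable_const.indicator hB_m).comp (measurable_id.sub measurable_const))]
    congr 1
    have h1 : ∫⁻ u, B.indicator (fun _ => (1 : ℝ≥0∞)) (u - fun i => Y i i) ∂π = ∫⁻ u, B.indicator (fun _ => (1 : ℝ≥0∞)) u ∂π := by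
      have h := lintegral_sub_right_eq_self (μ := π) (B.indicator fun _ => (1 : ℝ≥0∞)) (fun i => Y i i)
      exact h
    rw [h1, lintegral_indicator_const hB_m, one_mul, hπ, hB, Measure.pi_pi]
    simp only [Finset.prod_const, Finset.card_univ, Fintype.card_fin]
  -- (ii) integrate in `Y` first: the section at `u`
  have hY_inner : ∀ u : Fin 3 → F, ∫⁻ Y, Φ (u, Y) ∂μ𝔤 = U3.indicator (fun _ => ∫⁻ Y in Kk, Θ Y ∂μ𝔤) u := by
    intro u
    have hsec : ∀ Y, Φ (u, Y) = (D ∩ {Y | (u - fun i => Y i i) ∈ B}).indicator Θ Y := by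
      intro Y
      simp only [hΦ]
      by_cases hY : Y ∈ D
      · by_cases hb : (u - fun i => Y i i) ∈ B
        · rw [Set.indicator_of_mem hY, Set.indicator_of_mem hb, Set.indicator_of_mem (Set.mem_inter hY hb), mul_one]
        · rw [Set.indicator_of_notMem hb, mul_zero, Set.indicator_of_notMem (fun h => hb h.2)]
      · rw [Set.indicator_of_notMem hY, zero_mul, Set.indicator_of_notMem (fun h => hY h.1)]
    simp_rw [hsec]
    have hsec_m : MeasurableSet {Y : Matrix (Fin 3) (Fin 3) F | (u - fun i => Y i i) ∈ B} := (measurable_const.sub hdiag_m) hB_m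
    rw [lintegral_indicator (hD_m.inter hsec_m)]
    by_cases hu : ∀ i, normAbs F (u i) = 1
    · have huU : u ∈ U3 := Set.mem_univ_pi.2 fun i => by exact hu i
      rw [Set.indicator_of_mem huU]
      have hset : D ∩ {Y | (u - fun i => Y i i) ∈ B} = (fun Y' : Matrix (Fin 3) (Fin 3) F => Y' * Matrix.diagonal u) '' Kk :=
        section_eq_image_of_units hk hu
      rw [hset]
      -- change of variables `Y = Y' · diagonal u`
      have hR : Measurable fun Y' : Matrix (Fin 3) (Fin 3) F => Y' * Matrix.diagonal u := (continuous_id.matrix_mul continuous_const).measurable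
      have hu0 : ∀ j, u j ≠ 0 := fun j h => by have := hu j; rw [h, map_zero] at this; exact zero_ne_one this
      have hRinj : Function.Injective fun Y' : Matrix (Fin 3) (Fin 3) F => Y' * Matrix.diagonal u := by
        intro Y₁ Y₂ h
        have h' := congrArg (fun Z => Z * Matrix.diagonal fun j => (u j)⁻¹) h
        simpa only [Matrix.mul_assoc, Matrix.diagonal_mul_diagonal, mul_inv_cancel₀ (hu0 _), Matrix.diagonal_one, Matrix.mul_one] using h'
      calc ∫⁻ Y in (fun Y' : Matrix (Fin 3) (Fin 3) F => Y' * Matrix.diagonal u) '' Kk, Θ Y ∂μ𝔤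
          = ∫⁻ Y in (fun Y' : Matrix (Fin 3) (Fin 3) F => Y' * Matrix.diagonal u) '' Kk, Θ Y
              ∂(μ𝔤.map fun Y' : Matrix (Fin 3) (Fin 3) F => Y' * Matrix.diagonal u) := by rw [map_mul_diagonal_eq_self μ𝔤 u hu]
        _ = ∫⁻ Y' in (fun Y' : Matrix (Fin 3) (Fin 3) F => Y' * Matrix.diagonal u) ⁻¹'
              ((fun Y' : Matrix (Fin 3) (Fin 3) F => Y' * Matrix.diagonal u) '' Kk), Θ (Y' * Matrix.diagonal u) ∂μ𝔤 :=
            setLIntegral_map (hset ▸ hD_m.inter hsec_m) hΘm hR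
        _ = ∫⁻ Y' in Kk, Θ Y' ∂μ𝔤 := by
            rw [hRinj.preimage_image]
            exact setLIntegral_congr_fun hKk_m (fun Y' _ => hΘinv Y' u hu)
    · have huU : u ∉ U3 := fun h => hu fun i => by exact Set.mem_univ_pi.1 h i
      rw [Set.indicator_of_notMem huU, section_eq_empty_of_not_units hk hu]
      simp
  -- (iii) Tonelli
  have hT : ∫⁻ p, Φ p ∂(π.prod μ𝔤) = ∫⁻ u, ∫⁻ Y, Φ (u, Y) ∂μ𝔤 ∂π := lintegral_prod _ hΦm.aemeasurable
  have hT' : ∫⁻ p, Φ p ∂(π.prod μ𝔤) = ∫⁻ Y, ∫⁻ u, Φ (u, Y) ∂π ∂μ𝔤 := lintegral_prod_symm _ hΦm.aemeasurable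
  rw [hT'] at hT
  simp_rw [hu_inner, hY_inner] at hT
  rw [lintegral_mul_const _ (hΘm.indicator hD_m), lintegral_indicator hD_m, lintegral_indicator_const hU3_m, hπ, hU3, Measure.pi_pi] at hT
  simp only [Finset.prod_const, Finset.card_univ, Fintype.card_fin] at hT
  rw [mul_comm] at hT
  rw [hT, mul_comm]


variable [MeasurableSpace (GL (Fin 3) F)] [BorelSpace (GL (Fin 3) F)]

/-- **(IMF) THE LEVEL-`k` PRODUCT FORMULA WITH A LEVEL-UNIFORM CONSTANT.**  For a Haar measure `κ` of `K = GL₃(𝒪)`, additive Haar measures `μ𝔤` of `M₃(F)` and `dx` of `F`,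
there are `c ∈ (0, ∞)` and a depth `k₁` such that for all `k ≥ k₁` and every measurable `Θ ≥ 0` on `M₃(F)` with `Θ(Y · diagonal a) = Θ(Y)` whenever all `‖a_i‖_F = 1`:
`dx(𝔭^k)³ · ∫⁻_{k' ∈ K, off-diag(k') ∈ 𝔭^k} Θ(↑k') dκ = c · ∫⁻_{X ∈ M₃(𝔭^k)} Θ((1 + X⁺)(1 + X⁻)) dμ𝔤` (★ brick C + §4 averaging + ★ F1 ULD chart).
[cite: HarishChandra1999AdmissibleDistributions, Lemma 7.8] [cite: BernsteinZelevinsky1976, §3] [cite: WeilBNT1967, Ch. I §2] -/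
theorem exists_lintegral_offDiagLevel_eq (κ : Measure ↥(glInt 3 F)) [IsHaarMeasure κ] (μ𝔤 : Measure (Matrix (Fin 3) (Fin 3) F)) [μ𝔤.IsAddHaarMeasure]
    (dx : Measure F) [dx.IsAddHaarMeasure] :
    ∃ c : ℝ≥0∞, c ≠ 0 ∧ c ≠ ⊤ ∧ ∃ k₁ : ℕ, ∀ k : ℕ, k₁ ≤ k → ∀ Θ : Matrix (Fin 3) (Fin 3) F → ℝ≥0∞, Measurable Θ →
      (∀ (Y : Matrix (Fin 3) (Fin 3) F) (a : Fin 3 → F), (∀ i, normAbs F (a i) = 1) → Θ (Y * Matrix.diagonal a) = Θ Y) →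
      dx (primePowBall F k) ^ 3 *
          ∫⁻ k' in {k' : ↥(glInt 3 F) | ∀ i j, i ≠ j → ((k' : GL (Fin 3) F) : Matrix (Fin 3) (Fin 3) F) i j ∈ primePowBall F k},
            Θ ((k' : GL (Fin 3) F) : Matrix (Fin 3) (Fin 3) F) ∂κ =
        c * ∫⁻ X in {X : Matrix (Fin 3) (Fin 3) F | ∀ i j, X i j ∈ primePowBall F k},
          Θ ((1 + !![0, X 0 1, X 0 2; 0, 0, X 1 2; 0, 0, 0]) * (1 + !![0, 0, 0; X 1 0, 0, 0; X 2 0, X 2 1, 0])) ∂μ𝔤 := by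
  classical
  haveI : T2Space F := (isLocalField F).toT2Space
  haveI : LocallyCompactSpace F := (isLocalField F).toLocallyCompactSpace
  haveI : SecondCountableTopology F := secondCountableTopology_localField F
  haveI : IsTopologicalRing F := inferInstance
  -- ★ brick C and ★ F1
  obtain ⟨cK, hcK0, hcKt, hC⟩ := K2E3GLnIntegerPointsHaarVsAddHaar.exists_lintegral_glInt_eq_mul_setLIntegral (N := 3) μ𝔤 κ
  obtain ⟨k₀, hF1⟩ := exists_depth_uldChart μ𝔤 (fun X : Matrix (Fin 3) (Fin 3) F =>
    (1 + !![0, X 0 1, X 0 2; 0, 0, X 1 2; 0, 0, 0]) * (1 + !![0, 0, 0; X 1 0, 0, 0; X 2 0, X 2 1, 0]) * (1 + Matrix.diagonal (fun i => X i i))) rfl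
  -- the constant `c = c_K · dx(𝒪ˣ)³`
  have hUeq : {x : F | normAbs F x = 1} = primePowBall F 0 \ primePowBall F (0 + 1) := by
    ext x; rw [mem_shell_iff, zpow_zero]; rfl
  have hU_m : MeasurableSet {x : F | normAbs F x = 1} := measurableSet_eq_fun measurable_normAbs measurable_const
  have hU0 : dx {x : F | normAbs F x = 1} ≠ 0 := by
    have hopen : IsOpen {x : F | normAbs F x = 1} := by
      rw [hUeq]; exact (isOpen_primePowBall 0).sdiff (isCompact_primePowBall _).isClosed
    exact (hopen.measure_pos dx ⟨1, by simp⟩).ne'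
  have hUt : dx {x : F | normAbs F x = 1} ≠ ⊤ :=
    (measure_mono (fun x hx => by rw [hUeq] at hx; exact hx.1) |>.trans_lt (isCompact_primePowBall (F := F) 0).measure_lt_top).ne
  refine ⟨cK * dx {x : F | normAbs F x = 1} ^ 3, mul_ne_zero hcK0 (pow_ne_zero _ hU0), ENNReal.mul_ne_top hcKt (ENNReal.pow_ne_top hUt),
    max k₀ 1, fun k hk Θ hΘm hΘinv => ?_⟩
  have hk₀ : k₀ ≤ k := le_trans (le_max_left _ _) hk
  have hk1 : 1 ≤ k := le_trans (le_max_right _ _) hk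
  obtain ⟨-, himg, hlin⟩ := hF1 k hk₀
  -- sets and measurability
  set Off : Set (Matrix (Fin 3) (Fin 3) F) := {Y | ∀ i j, i ≠ j → Y i j ∈ primePowBall F k} with hOff
  have hball : MeasurableSet (primePowBall F (k : ℤ)) := (isOpen_primePowBall (F := F) k).measurableSet
  have hmeas_entry : ∀ i j : Fin 3, Measurable fun Y : Matrix (Fin 3) (Fin 3) F => Y i j := fun i j => (continuous_id.matrix_elem i j).measurable
  have hOff_m : MeasurableSet Off := by
    have h : Off = ⋂ i : Fin 3, ⋂ j : Fin 3, ⋂ (_ : i ≠ j), (fun Y : Matrix (Fin 3) (Fin 3) F => Y i j) ⁻¹' primePowBall F k := by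
      ext Y; simp only [hOff, Set.mem_setOf_eq, Set.mem_iInter, Set.mem_preimage]
    rw [h]; exact MeasurableSet.iInter fun i => MeasurableSet.iInter fun j => MeasurableSet.iInter fun _ => hmeas_entry i j hball
  have hBox_m : MeasurableSet {X : Matrix (Fin 3) (Fin 3) F | ∀ i j, X i j ∈ primePowBall F k} :=
    (Literature.MeasureTheory.Group.isOpen_setOf_forall_mem_primePowBall (F := F) (n := Fin 3) k).measurableSet
  have hcoe : Measurable fun k' : ↥(glInt 3 F) => ((k' : GL (Fin 3) F) : Matrix (Fin 3) (Fin 3) F) :=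
    (Units.continuous_val.comp continuous_subtype_val).measurable
  -- (1) the `κ`-integral through ★ brick C
  have h1 : ∫⁻ k' in {k' : ↥(glInt 3 F) | ∀ i j, i ≠ j → ((k' : GL (Fin 3) F) : Matrix (Fin 3) (Fin 3) F) i j ∈ primePowBall F k},
        Θ ((k' : GL (Fin 3) F) : Matrix (Fin 3) (Fin 3) F) ∂κ =
      cK * ∫⁻ Y in {Y : Matrix (Fin 3) (Fin 3) F | (∀ i j, Y i j ∈ 𝒪[F]) ∧ normAbs F Y.det = 1} ∩ Off, Θ Y ∂μ𝔤 := by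
    have hpre : {k' : ↥(glInt 3 F) | ∀ i j, i ≠ j → ((k' : GL (Fin 3) F) : Matrix (Fin 3) (Fin 3) F) i j ∈ primePowBall F k} =
        (fun k' : ↥(glInt 3 F) => ((k' : GL (Fin 3) F) : Matrix (Fin 3) (Fin 3) F)) ⁻¹' Off := rfl
    rw [hpre, ← lintegral_indicator (hcoe hOff_m)]
    have hind : ∀ k' : ↥(glInt 3 F), ((fun k' : ↥(glInt 3 F) => ((k' : GL (Fin 3) F) : Matrix (Fin 3) (Fin 3) F)) ⁻¹' Off).indicator
        (fun k' => Θ ((k' : GL (Fin 3) F) : Matrix (Fin 3) (Fin 3) F)) k' = Off.indicator Θ ((k' : GL (Fin 3) F) : Matrix (Fin 3) (Fin 3) F) :=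
      fun k' => (Set.indicator_comp_right _).symm
    simp_rw [hind]
    rw [hC (Off.indicator Θ) (hΘm.indicator hOff_m)]
    congr 1
    rw [lintegral_indicator hOff_m, Measure.restrict_restrict hOff_m, Set.inter_comm]
  -- (2) averaging and (3) the ULD chart
  have h2 := averaging_identity μ𝔤 dx hk1 Θ hΘm hΘinv
  have h3 : ∫⁻ Y in {Y : Matrix (Fin 3) (Fin 3) F | ∀ i j, (Y - 1) i j ∈ primePowBall F k}, Θ Y ∂μ𝔤 =
      ∫⁻ X in {X : Matrix (Fin 3) (Fin 3) F | ∀ i j, X i j ∈ primePowBall F k},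
        Θ ((1 + !![0, X 0 1, X 0 2; 0, 0, X 1 2; 0, 0, 0]) * (1 + !![0, 0, 0; X 1 0, 0, 0; X 2 0, X 2 1, 0])) ∂μ𝔤 := by
    rw [← hlin Θ hΘm]
    refine setLIntegral_congr_fun hBox_m fun X hX => ?_
    have hq1 : ((residueFieldCard F : ℝ≥0)⁻¹) ^ (k : ℤ) < 1 := by
      rw [zpow_natCast]
      exact pow_lt_one₀ (by simp) (inv_lt_one_of_one_lt₀ (by exact_mod_cast one_lt_residueFieldCard F)) (by omega)
    have hdiag : (1 : Matrix (Fin 3) (Fin 3) F) + Matrix.diagonal (fun i => X i i) = Matrix.diagonal (fun i => 1 + X i i) := by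
      rw [← Matrix.diagonal_one, Matrix.diagonal_add]
    show Θ ((1 + !![0, X 0 1, X 0 2; 0, 0, X 1 2; 0, 0, 0]) * (1 + !![0, 0, 0; X 1 0, 0, 0; X 2 0, X 2 1, 0]) * (1 + Matrix.diagonal (fun i => X i i))) = _
    rw [hdiag]
    exact hΘinv _ _ fun i => by
      rw [normAbs_add_eq_of_lt (by rw [map_one]; exact (mem_primePowBall_iff.1 (hX i i)).trans_lt hq1), map_one]
  rw [h1, ← mul_assoc, mul_comm (dx (primePowBall F k) ^ 3) cK, mul_assoc, h2, h3, ← mul_assoc]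

end Head

end Summit.HodgeConjecture.HodgeConjecture.Cruxes.H413.K2E3GL3DiagonalLevelProductMeasure

end
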